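import Summits.HodgeConjecture.HodgeConjecture.Theorems.GenericDivisibilityGenericDivisibilityBoundedLevelCleanFunnel
import HarnessLib

/-!
# C2 at `X` from INFINITELY MANY level-one-clean primes — a Bloch–Kato-free socket
# (crux `GenericDivisibilityBounded`, stmt-HodgeConjecture-18467, line `finite-level-bootstrap`)

Sorry-free, definition-free. For a smooth projective complex `X`, a degree `k`, `H = H^k(X(ℂ);ℤ)`,
`z| = z|_{(X∖Z)(ℂ)}` and `GT = {x : ∃ Z` closed `≠ univ, ∃ N ≥ 1, N • x| = 0}` (the generically
torsion classes), say that a prime `ℓ` is **clean at level one (exact form)** in degree `k` if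

  `∀ z ∈ H, (∃ Z` closed `≠ univ, ∃ y, ℓ • y = z|) → ∃ w, z - ℓ • w ∈ GT`

("a class divisible by `ℓ` on some non-empty Zariski open is divisible by `ℓ` modulo `GT`"; it is
implied by the line's `LevelClean ℓ 1` and by the mod-`ℓ` form `ModEllLift ℓ` of the crux ideas).

* `genericDivisibilityBounded_mem_of_infinite_prime` — lattice algebra: in a finitely generated
  abelian group `M` with a SATURATED subgroup `S`, an element congruent to an `ℓ`-multiple modulo
  `S` for infinitely many primes `ℓ` lies in `S` (`M/S` is finitely generated and torsion-free,
  hence free; a non-zero coordinate has finitely many prime divisors).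
* `genericDivisibilityBounded_at_of_infinite_levelOneClean` — **C2 at `X` in degree `k` as soon as
  infinitely many primes are clean at level one.** No bootstrap, no Krull, and — unlike the
  one-prime funnel at level one (`levelClean_one_of_modEllLift` of the skeleton) — NO use of the
  support item `TorsionDiesGenerically` (Colliot-Thélène–Voisin 2012 Thm 3.1 / Bloch–Kato): the
  crux hypothesis hands over EXACT divisibility, which the exact form consumes directly.
* `genericDivisibilityBounded_at_of_infinite_modEllLift` — the same with the mod-`ℓ` hypothesis of
  the ideas `galois-rigidity-dichotomy` (`FirstLemmaB'`: "`X_1(ℓ) = 0` for infinitely many `ℓ`")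
  and `ordinary-prime-periods` (`Q(X)[p] = 0` at infinitely many ordinary primes): if for
  infinitely many primes `ℓ` every integral class whose reduction mod `ℓ` dies on a non-empty
  Zariski open lies in `ℓ H + GT`, then C2 holds at `X`.
* `stub_cruxAtOfInfiniteCleanPrimes` — the registered sub-goal of the skeleton, verbatim.

Why this is the right socket for those ideas: for `X = E⁴` (`E` non-CM) Serre's open image makes the
transcendental lattice irreducible mod `ℓ` for all large `ℓ` and Bloch–Esnault 1996 Thm 1.2 gives a
non-liftable witness at every ordinary prime (density one), so level one is clean at infinitely many
primes; for CM `E` every split prime not dividing the index of `N¹ ⊕ T` is clean (complex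
conjugation swaps the two unit-root eigenlines). In both cases C2(E⁴) follows from THIS theorem with
no norm-residue input.

References: [ColliotTheleneVoisin2012] §3–4 (context only); [HatcherAT2002] §3.1 (change of
coefficients commutes with pull-back); Bloch–Esnault, Math. Ann. 304 (1996) Thm 1.2 (the source of
clean primes, not used in the proofs). -/

set_option linter.dupNamespace false

noncomputable section

namespace Summit.HodgeConjecture.HodgeConjecture.Theorems

open CategoryTheory AlgebraicGeometry
open Literature.AlgebraicGeometry.Motives Literature.AlgebraicGeometry.HodgeTheory
  Literature.AlgebraicTopology.SingularHomology

/-- Restriction `H^k(X(ℂ);ℤ) → H^k((X∖Z)(ℂ);ℤ)`, the very term of the route decls (notation only). -/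
local notation3 (prettyPrint := false) "Res[" X ", " Z ", " k "]" =>
  singularCohomology.map ℤ ℤ
    (⟨Subtype.val, continuous_subtype_val⟩ : C(complexPointsCompl X Z, ComplexPoints X)) k

/-! ### Lattice algebra: infinitely many prime divisors modulo a saturated subgroup -/

/-- In a finitely generated abelian group `M` with a SATURATED subgroup `S` (`N • x ∈ S`, `N ≥ 1 ⇒
x ∈ S`), an element `z` with `z - ℓ • w_ℓ ∈ S` for infinitely many primes `ℓ` lies in `S`: the
quotient `M/S` is finitely generated and torsion-free, hence free (structure theorem over the PID
`ℤ`), and a non-zero coordinate of `z̄` in a basis would be divisible by infinitely many primes.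
[folklore] -/
theorem genericDivisibilityBounded_mem_of_infinite_prime {M : Type} [AddCommGroup M]
    [Module.Finite ℤ M] (S : AddSubgroup M)
    (hsat : ∀ (N : ℕ) (x : M), 1 ≤ N → N • x ∈ S → x ∈ S) {z : M}
    (hz : {ℓ : ℕ | ℓ.Prime ∧ ∃ w : M, z - ℓ • w ∈ S}.Infinite) : z ∈ S := by
  let S' : Submodule ℤ M := AddSubgroup.toIntSubmodule S
  letI : Module ℤ (M ⧸ S') := Submodule.Quotient.module S'
  haveI : Module.Finite ℤ (M ⧸ S') := Module.Finite.quotient ℤ S'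
  -- `M/S` is torsion-free because `S` is saturated
  haveI : Module.IsTorsionFree ℤ (M ⧸ S') := by
    refine Module.IsTorsionFree.of_smul_eq_zero fun c q hcq ↦ ?_
    by_cases hc : c = 0
    · exact Or.inl hc
    · right
      induction q using Submodule.Quotient.induction_on with
      | H x =>
        rw [← Submodule.Quotient.mk_smul, Submodule.Quotient.mk_eq_zero] at hcq
        rw [Submodule.Quotient.mk_eq_zero]
        change c • x ∈ S at hcq
        change x ∈ S
        have hn : 1 ≤ c.natAbs := Nat.one_le_iff_ne_zero.2 (Int.natAbs_ne_zero.2 hc)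
        refine hsat c.natAbs x hn ?_
        have h' : (c.natAbs : ℤ) • x ∈ S := by
          rw [← Int.sign_mul_self_eq_natAbs, mul_zsmul]
          exact S.zsmul_mem hcq _
        rwa [natCast_zsmul] at h'
  -- hence free; take coordinates in a basis
  let b := Module.Free.chooseBasis ℤ (M ⧸ S')
  by_contra hzS
  have hne : Submodule.Quotient.mk (p := S') z ≠ 0 := by
    rwa [Ne, Submodule.Quotient.mk_eq_zero]
  obtain ⟨i, hi⟩ : ∃ i, b.repr (Submodule.Quotient.mk (p := S') z) i ≠ 0 := by
    by_contra h
    push Not at h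
    exact hne (b.repr.injective (by ext j; rw [h j, map_zero, Finsupp.zero_apply]))
  -- every prime of the family divides the `i`-th coordinate of `z̄`
  have hdvd : {ℓ : ℕ | ℓ.Prime ∧ ∃ w : M, z - ℓ • w ∈ S} ⊆
      {ℓ : ℕ | ℓ ≤ (b.repr (Submodule.Quotient.mk (p := S') z) i).natAbs} := by
    rintro ℓ ⟨-, w, hw⟩
    have hzw : Submodule.Quotient.mk (p := S') z =
        Submodule.Quotient.mk (p := S') ((ℓ : ℤ) • w) := by
      rw [← sub_eq_zero, ← Submodule.Quotient.mk_sub, Submodule.Quotient.mk_eq_zero, natCast_zsmul]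
      exact hw
    have hcoord : b.repr (Submodule.Quotient.mk (p := S') z) i =
        (ℓ : ℤ) * b.repr (Submodule.Quotient.mk (p := S') w) i := by
      rw [hzw, Submodule.Quotient.mk_smul, map_smul, Finsupp.smul_apply, smul_eq_mul]
    have hd : (ℓ : ℤ) ∣ b.repr (Submodule.Quotient.mk (p := S') z) i := ⟨_, hcoord⟩
    exact Nat.le_of_dvd (Int.natAbs_pos.2 hi) (Int.natCast_dvd.1 hd)
  exact hz ((Set.finite_le_nat _).subset hdvd)

/-- The same for `GT ⊆ H^k(X(ℂ);ℤ)` on a smooth projective `X`: if `z ≡ ℓ • w_ℓ (mod GT)` for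
infinitely many primes `ℓ` then `z ∈ GT` (`H^k(X(ℂ);ℤ)` is finitely generated —
`bettiCohomologyInt_finite_holds` — and `GT` is a saturated subgroup). [folklore] -/
theorem genericDivisibilityBounded_genericallyTorsion_of_infinite_prime {n₀ : ℕ} {X : SchemeOver ℂ}
    (hX : IsSmoothProjective n₀ X) {k : ℕ} {z : singularCohomology ℤ ℤ (ComplexPoints X) k}
    (hz : {ℓ : ℕ | ℓ.Prime ∧ ∃ w : singularCohomology ℤ ℤ (ComplexPoints X) k, ∃ Z : Set X.left,
      IsClosed Z ∧ Z ≠ Set.univ ∧ ∃ N : ℕ, 1 ≤ N ∧ N • Res[X, Z, k] (z - ℓ • w) = 0}.Infinite) :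
    ∃ Z : Set X.left, IsClosed Z ∧ Z ≠ Set.univ ∧ ∃ N : ℕ, 1 ≤ N ∧ N • Res[X, Z, k] z = 0 := by
  haveI : IsIntegral X.left := IsSmoothProjective.isIntegral_holds hX
  -- finite generation, transported to the canonical `ℤ`-module structure
  haveI : @Module.Finite ℤ (singularCohomology ℤ ℤ (ComplexPoints X) k) _ _
      (AddCommGroup.toIntModule _) := by
    convert bettiCohomologyInt_finite_holds hX k
    exact Subsingleton.elim _ _
  let S : AddSubgroup (singularCohomology ℤ ℤ (ComplexPoints X) k) :=
    { carrier := {x | ∃ Z : Set X.left, IsClosed Z ∧ Z ≠ Set.univ ∧ ∃ N : ℕ, 1 ≤ N ∧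
        N • Res[X, Z, k] x = 0}
      add_mem' := fun ha hb ↦ genericDivisibilityBounded_genericallyTorsion_add ha hb
      zero_mem' := ⟨∅, isClosed_empty, fun h ↦ (Set.empty_ne_univ h).elim, 1, le_rfl,
        by rw [map_zero, smul_zero]⟩
      neg_mem' := fun ha ↦ genericDivisibilityBounded_genericallyTorsion_neg ha }
  have hS : z ∈ S :=
    genericDivisibilityBounded_mem_of_infinite_prime S
      (fun N x hN hx ↦ genericDivisibilityBounded_genericallyTorsion_of_nsmul hN hx)
      (hz.mono fun ℓ hℓ ↦ by obtain ⟨hℓp, w, hw⟩ := hℓ; exact ⟨hℓp, w, hw⟩)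
  exact hS

/-! ### C2 at `X` from infinitely many clean primes -/

/-- **C2 at `X` from infinitely many level-one-clean primes (exact form), Bloch–Kato-free.** On a
smooth projective `X`, suppose that for infinitely many primes `ℓ` every class of `H^k(X(ℂ);ℤ)`
divisible by `ℓ` on the complex points of some non-empty Zariski open is congruent to an
`ℓ`-multiple modulo `GT`. Then every `z` divisible by every `m ≥ 1` on non-empty Zariski opens has
complexification in `supportedClasses X k 1`: at each clean prime the crux hypothesis with `m = ℓ`
gives `z ∈ ℓ H + GT`, the lattice lemma gives `z ∈ GT`, and `GT ⊗ ℂ ⊆ N¹`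
(`genericDivisibilityBounded_ringChange_mem_supportedClasses`). [folklore] -/
theorem genericDivisibilityBounded_at_of_infinite_levelOneClean {n₀ : ℕ} {X : SchemeOver ℂ}
    (hX : IsSmoothProjective n₀ X) (k : ℕ)
    (hinf : {ℓ : ℕ | ℓ.Prime ∧ ∀ z : singularCohomology ℤ ℤ (ComplexPoints X) k,
      (∃ Z : Set X.left, IsClosed Z ∧ Z ≠ Set.univ ∧
        ∃ y : singularCohomology ℤ ℤ (complexPointsCompl X Z) k, ℓ • y = Res[X, Z, k] z) →
      ∃ w : singularCohomology ℤ ℤ (ComplexPoints X) k, ∃ Z : Set X.left, IsClosed Z ∧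
        Z ≠ Set.univ ∧ ∃ N : ℕ, 1 ≤ N ∧ N • Res[X, Z, k] (z - ℓ • w) = 0}.Infinite)
    (z : singularCohomology ℤ ℤ (ComplexPoints X) k)
    (hz : ∀ m : ℕ, 1 ≤ m → ∃ Z : Set X.left, IsClosed Z ∧ Z ≠ Set.univ ∧
      ∃ y : singularCohomology ℤ ℤ (complexPointsCompl X Z) k, m • y = Res[X, Z, k] z) :
    singularCohomology.ringChange (Int.castRingHom ℂ) (ComplexPoints X) k z ∈
      supportedClasses X k 1 := by
  refine genericDivisibilityBounded_ringChange_mem_supportedClasses hX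
    (genericDivisibilityBounded_genericallyTorsion_of_infinite_prime hX (hinf.mono ?_))
  rintro ℓ ⟨hℓ, hclean⟩
  exact ⟨hℓ, hclean z (hz ℓ hℓ.one_lt.le)⟩

/-! ### The mod-`ℓ` form handed over by the crux ideas -/

/-- Change of coefficients `ℤ → ℤ/ℓ` commutes with pull-back (cocycle level, Hatcher §3.1 p. 198).
[cite: HatcherAT2002, §3.1] -/
theorem genericDivisibilityBounded_ringChange_zmod_map {S T : Type} [TopologicalSpace S]
    [TopologicalSpace T] (ℓ : ℕ) (f : C(S, T)) (n : ℕ) (x : singularCohomology ℤ ℤ T n) :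
    singularCohomology.ringChange (Int.castRingHom (ZMod ℓ)) S n (singularCohomology.map ℤ ℤ f n x) =
      singularCohomology.map (ZMod ℓ) (ZMod ℓ) f n
        (singularCohomology.ringChange (Int.castRingHom (ZMod ℓ)) T n x) := by
  induction x using singularCohomology_induction_on with
  | h u =>
    rw [singularCohomology.map_π, singularCohomology.ringChange_π, singularCohomology.ringChange_π,
      singularCohomology.map_π]
    congr 1
    refine coFn_injective ?_
    rw [coFn_cocyclesRingChange, coFn_cocyclesMap, coFn_cocyclesMap, coFn_cocyclesRingChange]
    rfl

/-- A class divisible by `ℓ` on `(X∖Z)(ℂ)` has reduction mod `ℓ` vanishing there. [folklore] -/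
theorem genericDivisibilityBounded_zmod_restrict_eq_zero_of_dvd {X : SchemeOver ℂ} {Z : Set X.left}
    {k ℓ : ℕ} {z : singularCohomology ℤ ℤ (ComplexPoints X) k}
    {y : singularCohomology ℤ ℤ (complexPointsCompl X Z) k} (hy : ℓ • y = Res[X, Z, k] z) :
    singularCohomology.map (ZMod ℓ) (ZMod ℓ)
        (⟨Subtype.val, continuous_subtype_val⟩ : C(complexPointsCompl X Z, ComplexPoints X)) k
        (singularCohomology.ringChange (Int.castRingHom (ZMod ℓ)) (ComplexPoints X) k z) = 0 := by
  rw [← genericDivisibilityBounded_ringChange_zmod_map, ← hy, map_nsmul,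
    ← Nat.cast_smul_eq_nsmul (ZMod ℓ), ZMod.natCast_self, zero_smul]

/-- **C2 at `X` from infinitely many primes at which mod-`ℓ` coniveau one lifts** (`Q(X)[ℓ] = 0`,
the `FirstLemmaB'` of idea `galois-rigidity-dichotomy` and the many-ordinary-primes form of idea
`ordinary-prime-periods`), Bloch–Kato-free: if for infinitely many primes `ℓ` every integral class
whose reduction mod `ℓ` dies on the complex points of some non-empty Zariski open lies in
`ℓ H + GT`, then C2 holds at `X` in degree `k`. [folklore] -/
theorem genericDivisibilityBounded_at_of_infinite_modEllLift {n₀ : ℕ} {X : SchemeOver ℂ}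
    (hX : IsSmoothProjective n₀ X) (k : ℕ)
    (hinf : {ℓ : ℕ | ℓ.Prime ∧ ∀ z : singularCohomology ℤ ℤ (ComplexPoints X) k,
      (∃ Z : Set X.left, IsClosed Z ∧ Z ≠ Set.univ ∧
        singularCohomology.map (ZMod ℓ) (ZMod ℓ)
          (⟨Subtype.val, continuous_subtype_val⟩ : C(complexPointsCompl X Z, ComplexPoints X)) k
          (singularCohomology.ringChange (Int.castRingHom (ZMod ℓ)) (ComplexPoints X) k z) = 0) →
      ∃ w : singularCohomology ℤ ℤ (ComplexPoints X) k, ∃ Z : Set X.left, IsClosed Z ∧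
        Z ≠ Set.univ ∧ ∃ N : ℕ, 1 ≤ N ∧ N • Res[X, Z, k] (z - ℓ • w) = 0}.Infinite)
    (z : singularCohomology ℤ ℤ (ComplexPoints X) k)
    (hz : ∀ m : ℕ, 1 ≤ m → ∃ Z : Set X.left, IsClosed Z ∧ Z ≠ Set.univ ∧
      ∃ y : singularCohomology ℤ ℤ (complexPointsCompl X Z) k, m • y = Res[X, Z, k] z) :
    singularCohomology.ringChange (Int.castRingHom ℂ) (ComplexPoints X) k z ∈
      supportedClasses X k 1 := by
  refine genericDivisibilityBounded_at_of_infinite_levelOneClean hX k (hinf.mono ?_) z hz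
  rintro ℓ ⟨hℓ, hlift⟩
  refine ⟨hℓ, fun z' hz' ↦ hlift z' ?_⟩
  obtain ⟨Z, hZ, hZne, y, hy⟩ := hz'
  exact ⟨Z, hZ, hZne, genericDivisibilityBounded_zmod_restrict_eq_zero_of_dvd hy⟩

/-- **Registered sub-goal `stub_cruxAtOfInfiniteCleanPrimes` of stmt-HodgeConjecture-18467: the crux
at `X` (any degree `k`) from infinitely many level-one-clean primes (exact form)** — verbatim
`genericDivisibilityBounded_at_of_infinite_levelOneClean`. [folklore] -/
theorem stub_cruxAtOfInfiniteCleanPrimes :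
    ∀ ⦃n₀ : ℕ⦄ ⦃X : SchemeOver ℂ⦄, IsSmoothProjective n₀ X → ∀ (k : ℕ),
      {ℓ : ℕ | ℓ.Prime ∧ ∀ z : singularCohomology ℤ ℤ (ComplexPoints X) k,
        (∃ Z : Set X.left, IsClosed Z ∧ Z ≠ Set.univ ∧
          ∃ y : singularCohomology ℤ ℤ (complexPointsCompl X Z) k,
            ℓ • y = singularCohomology.map ℤ ℤ
              (⟨Subtype.val, continuous_subtype_val⟩ : C(complexPointsCompl X Z, ComplexPoints X))
              k z) →
        ∃ w : singularCohomology ℤ ℤ (ComplexPoints X) k, ∃ Z : Set X.left, IsClosed Z ∧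
          Z ≠ Set.univ ∧ ∃ N : ℕ, 1 ≤ N ∧ N • singularCohomology.map ℤ ℤ
            (⟨Subtype.val, continuous_subtype_val⟩ : C(complexPointsCompl X Z, ComplexPoints X))
            k (z - ℓ • w) = 0}.Infinite →
      ∀ z : singularCohomology ℤ ℤ (ComplexPoints X) k,
        (∀ m : ℕ, 1 ≤ m → ∃ Z : Set X.left, IsClosed Z ∧ Z ≠ Set.univ ∧
          ∃ y : singularCohomology ℤ ℤ (complexPointsCompl X Z) k,
            m • y = singularCohomology.map ℤ ℤ
              (⟨Subtype.val, continuous_subtype_val⟩ : C(complexPointsCompl X Z, ComplexPoints X))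
              k z) →
        singularCohomology.ringChange (Int.castRingHom ℂ) (ComplexPoints X) k z ∈
          supportedClasses X k 1 :=
  fun _ _ hX k hinf z hz ↦ genericDivisibilityBounded_at_of_infinite_levelOneClean hX k hinf z hz

end Summit.HodgeConjecture.HodgeConjecture.Theorems

end
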